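import Mathlib
import HarnessLib

/-!
# Transcendence measure for `e` (Nesterenko–Waldschmidt 1996) — V: the parameters

Topic `Literature/NumberTheory/Transcendental`; sibling proof file of
`ExpOneTranscendenceMeasure.lean` (the named fact
`Literature.NumberTheory.Transcendental.NesterenkoWaldschmidt1996_thm_4_2`). Everything here is
PROVED; no definitions, no named facts; elementary real inequalities only.

This part is the choice of parameters of [NesterenkoWaldschmidt1996, §6] in the special case
`θ = β = 1`, `α = ξ` of Theorem 4, and the numerical verification replacing (6.4)–(6.11) there.
We use the functions `z^τ e^{tz}` (`0 ≤ τ ≤ T`, `|t| ≤ T₁`) instead of the binomial polynomials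
`Δ(z, τ, H) e^{tz}` of §4 (for `θ = 1` the factorials they save cost more than they gain, and this
avoids Lemma 4 and the prime number estimate `log lcm(1,…,H) ≤ 1.04 H`), with

  `X = D + ℓ` (`D = deg ξ`, `ℓ ≥ max(1, log M(ξ))`, so `X = D log A` with `log A = 1 + ℓ/D`),
  `E = e X`, `V = X / log E`, `T₁ = 10 D`, `S₁ = 40 D`, `T = ⌊3000 D V⌋`, `S = ⌊1200 D V⌋`,
  `L = (T+1)(2T₁+1)`, `m = S₁ (T+1) T₁ (T₁+1)`.

`NW1996.params_basic`, `NW1996.params_counts` and `NW1996.params_main` prove: `E ≥ e`,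
`1 ≤ log E ≤ X`, `V ≥ 1`; the zero-estimate condition (2.1) in the form
`(2T₁+1) T < (S + 1 - 2T₁)(2S₁+1)`; the size of the conclusion `L log E ≤ 63021 D² X`; and the main
inequality (the analogue of "`84.83 DUVW log E < ½ L log E`", p. 6)

  `L log 2 + D L log L + D L (T log S₁ + S log(T+T₁)) + (T+S) L log E + L E T₁ S₁ + 2 m ℓ + m log 4
     < ½ L (L-1) log E`,

which compares the analytic upper bound (Lemma 3) with Liouville's lower bound (Lemma 5) for the
interpolation determinant. All constants are crude (margins of about 25%).

## References

* [NesterenkoWaldschmidt1996] Yu. V. Nesterenko, M. Waldschmidt, *On the approximation of the values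
  of exponential function and logarithm by algebraic numbers*, Mat. Zapiski 2 (1996), 23–42;
  arXiv:math/0002047, §6 (choice of parameters, (6.4)–(6.11)).
-/

noncomputable section

namespace Literature.NumberTheory.Transcendental

namespace NW1996

/-! ### Numerical constants -/

/-- `2.7 < e < 2.72`. [folklore] -/
theorem e_bounds : (2.7 : ℝ) < Real.exp 1 ∧ Real.exp 1 < 2.72 :=
  ⟨by have := Real.exp_one_gt_d9; linarith, by have := Real.exp_one_lt_d9; linarith⟩

/-- `log x < n` as soon as `x < 2.7^n`. [folklore] -/
theorem log_lt_nat_of_lt_pow {x : ℝ} (hx : 0 < x) (n : ℕ) (h : x < (2.7 : ℝ) ^ n) :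
    Real.log x < n := by
  rw [Real.log_lt_iff_lt_exp hx]
  calc x < 2.7 ^ n := h
    _ ≤ Real.exp 1 ^ n := by gcongr; exact e_bounds.1.le
    _ = Real.exp n := by rw [← Real.exp_nat_mul, mul_one]

/-! ### Polynomial inequalities in the parameters -/

/-- The zero estimate count: `(20D+1)·3000DV < (1200DV - 20D)(80D+1)`. [folklore] -/
theorem ineq_zero_estimate (D V : ℝ) (hD : 1 ≤ D) (hV : 1 ≤ V) :
    (2 * (10 * D) + 1) * (3000 * D * V) < (1200 * D * V - 2 * (10 * D)) * (2 * (40 * D) + 1) := by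
  have h1 : 0 ≤ (V - 1) * (D * (36000 * D - 1800)) :=
    mul_nonneg (by linarith) (mul_nonneg (by linarith) (by linarith))
  nlinarith [mul_nonneg (by linarith : (0 : ℝ) ≤ D - 1) (by linarith : (0 : ℝ) ≤ D)]

/-- `L = (T+1)(2T₁+1) ≤ 63021 D² V`. [folklore] -/
theorem ineq_L_upper (D V T : ℝ) (hD : 1 ≤ D) (hV : 1 ≤ V) (hT : T ≤ 3000 * D * V) :
    (T + 1) * (2 * (10 * D) + 1) ≤ 63021 * D ^ 2 * V := by
  have h1 : (T + 1) * (2 * (10 * D) + 1) ≤ (3000 * D * V + 1) * (2 * (10 * D) + 1) :=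
    mul_le_mul_of_nonneg_right (by linarith) (by linarith)
  have h2 : (3000 * D * V + 1) * (2 * (10 * D) + 1) ≤ 63021 * D ^ 2 * V := by
    have h3 : 0 ≤ (D - 1) * (D * V) := mul_nonneg (by linarith) (by nlinarith)
    have h4 : 0 ≤ D * (D * V - 1) := mul_nonneg (by linarith) (by nlinarith)
    nlinarith
  linarith

/-- `L = (T+1)(2T₁+1) > 60000 D² V`. [folklore] -/
theorem ineq_L_lower (D V T : ℝ) (hD : 1 ≤ D) (hV : 1 ≤ V) (hT : 3000 * D * V < T + 1) :
    60000 * D ^ 2 * V < (T + 1) * (2 * (10 * D) + 1) := by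
  have h1 : (3000 * D * V) * (2 * (10 * D) + 1) < (T + 1) * (2 * (10 * D) + 1) :=
    mul_lt_mul_of_pos_right hT (by linarith)
  nlinarith [mul_nonneg (by linarith : (0 : ℝ) ≤ D) (by linarith : (0 : ℝ) ≤ V)]

/-- `2m = 2 S₁(T+1)T₁(T₁+1) ≤ 440 L D²`. [folklore] -/
theorem ineq_m (D T : ℝ) (hD : 1 ≤ D) (hT0 : 0 ≤ T) :
    2 * (40 * D * (T + 1) * (10 * D * (10 * D + 1))) ≤ 440 * ((T + 1) * (2 * (10 * D) + 1)) * D ^ 2 := by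
  have h : 0 ≤ (T + 1) * D ^ 2 * (800 * D) := by positivity
  nlinarith

/-- `E T₁ S₁ = 400 e D² X ≤ 1088 D² X`. [folklore] -/
theorem ineq_ET₁S₁ (D X e : ℝ) (hX : 0 < X) (he : e < 2.72) :
    e * X * (10 * D) * (40 * D) ≤ 1088 * (D ^ 2 * X) := by
  have : 0 ≤ (2.72 - e) * (D ^ 2 * X) := mul_nonneg (by linarith) (by positivity)
  nlinarith

/-! ### Logarithms of the parameters -/

/-- `log L ≤ 12 (1 + log X)`. [folklore] -/
theorem log_L_le (D V X L : ℝ) (hD : 1 ≤ D) (hV1 : 1 ≤ V) (hX : 2 ≤ X) (hDX : D ≤ X) (hVX : V ≤ X)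
    (hL0 : 0 < L) (hL : L ≤ 63021 * D ^ 2 * V) : Real.log L ≤ 12 * (1 + Real.log X) := by
  have hX0 : 0 ≤ X := by linarith
  have h1 : L ≤ 63021 * X ^ 3 := by
    have : D ^ 2 * V ≤ X ^ 2 * X := by gcongr
    nlinarith
  have h2 : Real.log L ≤ Real.log 63021 + 3 * Real.log X := by
    calc Real.log L ≤ Real.log (63021 * X ^ 3) := Real.log_le_log hL0 h1
      _ = Real.log 63021 + 3 * Real.log X := by
          rw [Real.log_mul (by norm_num) (by positivity), Real.log_pow]; push_cast; ring
  have h3 : Real.log 63021 < (12 : ℕ) := log_lt_nat_of_lt_pow (by norm_num) 12 (by norm_num)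
  have h4 : 0 ≤ Real.log X := Real.log_nonneg (by linarith)
  push_cast at h3
  linarith

/-- `log S₁ = log (40 D) ≤ 3 (1 + log X)`. [folklore] -/
theorem log_S₁_le (D X : ℝ) (hD : 1 ≤ D) (hX : 2 ≤ X) (hDX : D ≤ X) :
    Real.log (40 * D) ≤ 3 * (1 + Real.log X) := by
  rw [Real.log_mul (by norm_num) (by positivity)]
  have h : Real.log 40 < (4 : ℕ) := log_lt_nat_of_lt_pow (by norm_num) 4 (by norm_num)
  have hlogX : (0.69 : ℝ) ≤ Real.log X := by
    have := Real.log_two_gt_d9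
    have := Real.log_le_log (by norm_num) hX
    linarith
  have hlogDX : Real.log D ≤ Real.log X := Real.log_le_log (by positivity) hDX
  push_cast at h
  linarith

/-- `log (T + T₁) ≤ 7 (1 + log X)`. [folklore] -/
theorem log_TT₁_le (D V X T : ℝ) (hD : 1 ≤ D) (hV1 : 1 ≤ V) (hX : 2 ≤ X) (hDX : D ≤ X)
    (hVX : V ≤ X) (hT0 : 0 ≤ T) (hT : T ≤ 3000 * D * V) :
    Real.log (T + 10 * D) ≤ 7 * (1 + Real.log X) := by
  have hX0 : 0 ≤ X := by linarith
  have h1 : T + 10 * D ≤ 3010 * X ^ 2 := by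
    have h1 : D * V ≤ X * X := by gcongr
    have h2 : D ≤ X * X := by nlinarith
    nlinarith
  have h2 : Real.log (T + 10 * D) ≤ Real.log 3010 + 2 * Real.log X := by
    calc Real.log (T + 10 * D) ≤ Real.log (3010 * X ^ 2) := Real.log_le_log (by linarith) h1
      _ = Real.log 3010 + 2 * Real.log X := by
          rw [Real.log_mul (by norm_num) (by positivity), Real.log_pow]; push_cast; ring
  have h3 : Real.log 3010 < (9 : ℕ) := log_lt_nat_of_lt_pow (by norm_num) 9 (by norm_num)
  have hlogX : (0.69 : ℝ) ≤ Real.log X := by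
    have := Real.log_two_gt_d9
    have := Real.log_le_log (by norm_num) hX
    linarith
  push_cast at h3
  linarith

/-! ### The parameters -/

/-- **Basic facts** ([NesterenkoWaldschmidt1996, §6] for `θ = β = 1`): with `X = D + ℓ ≥ 2`,
`E = eX`, `V = X / log E`: `e ≤ E`, `log E = 1 + log X`, `1.69 ≤ log E ≤ X`, `1 ≤ V ≤ X`,
`V log E = X`. [cite: NesterenkoWaldschmidt1996, §6] -/
theorem params_basic (D : ℕ) (hD : 1 ≤ D) (ℓ : ℝ) (hℓ : 1 ≤ ℓ) {X E lgE V : ℝ} (hX : X = D + ℓ)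
    (hE : E = Real.exp 1 * X) (hlgE : lgE = Real.log E) (hV : V = X / lgE) :
    Real.exp 1 ≤ E ∧ lgE = 1 + Real.log X ∧ (1.69 : ℝ) ≤ lgE ∧ lgE ≤ X ∧ 1 ≤ V ∧ V ≤ X ∧
      V * lgE = X := by
  obtain ⟨he1, -⟩ := e_bounds
  have hDr : (1 : ℝ) ≤ D := by exact_mod_cast hD
  have hX2 : 2 ≤ X := by rw [hX]; linarith
  have hXpos : 0 < X := by linarith
  have hlogX : (0.69 : ℝ) ≤ Real.log X := by
    have := Real.log_two_gt_d9
    have := Real.log_le_log (by norm_num) hX2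
    linarith
  have hlogXle : Real.log X ≤ X - 1 := Real.log_le_sub_one_of_pos hXpos
  have hEe : Real.exp 1 ≤ E := by rw [hE]; nlinarith
  have hlgE_eq : lgE = 1 + Real.log X := by
    rw [hlgE, hE, Real.log_mul (Real.exp_pos 1).ne' hXpos.ne', Real.log_exp]
  have hlgE169 : (1.69 : ℝ) ≤ lgE := by rw [hlgE_eq]; linarith
  have hlgEpos : 0 < lgE := by linarith
  have hlgEX : lgE ≤ X := by rw [hlgE_eq]; linarith
  have hV1 : 1 ≤ V := by rw [hV, le_div_iff₀ hlgEpos]; linarith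
  have hVX : V * lgE = X := by rw [hV]; field_simp
  have hVleX : V ≤ X := by rw [hV]; exact div_le_self hXpos.le (by linarith)
  exact ⟨hEe, hlgE_eq, hlgE169, hlgEX, hV1, hVleX, hVX⟩

/-- **The counting conditions** ([NesterenkoWaldschmidt1996, §6] for `θ = β = 1`): with
`T₁ = 10D`, `S₁ = 40D`, `T = ⌊3000DV⌋`, `S = ⌊1200DV⌋`, `L = (T+1)(2T₁+1)`, `V ≥ 1`,
`V log E = X`: `2T₁ < S + 1`, the zero estimate condition `(2T₁+1)T < (S+1-2T₁)(2S₁+1)` (this is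
(2.1) with `D₀ = T`, `D₁ = 2T₁`, `M = 2S₁+1`, `S ← S+1`), `60000 D² V < L ≤ 63021 D² V` and
`L log E ≤ 63021 D² X`. [cite: NesterenkoWaldschmidt1996, §6 (6.4)] -/
theorem params_counts (D : ℕ) (hD : 1 ≤ D) {X lgE V : ℝ} (hV1 : 1 ≤ V) (hlgE0 : 0 < lgE)
    (hVX : V * lgE = X) {T₁ S₁ T S L : ℕ} (hT₁ : T₁ = 10 * D) (hS₁ : S₁ = 40 * D)
    (hT : T = ⌊3000 * (D : ℝ) * V⌋₊) (hS : S = ⌊1200 * (D : ℝ) * V⌋₊)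
    (hL : L = (T + 1) * (2 * T₁ + 1)) :
    2 * T₁ < S + 1 ∧ (2 * T₁ + 1) * T < (S + 1 - 2 * T₁) * (2 * S₁ + 1) ∧
      60000 * (D : ℝ) ^ 2 * V < L ∧ (L : ℝ) ≤ 63021 * (D : ℝ) ^ 2 * V ∧
      (L : ℝ) * lgE ≤ 63021 * (D : ℝ) ^ 2 * X := by
  have hDr : (1 : ℝ) ≤ D := by exact_mod_cast hD
  have hTle : (T : ℝ) ≤ 3000 * D * V := by rw [hT]; exact Nat.floor_le (by positivity)
  have hTlt : 3000 * (D : ℝ) * V < T + 1 := by rw [hT]; exact Nat.lt_floor_add_one _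
  have hSlt : 1200 * (D : ℝ) * V < S + 1 := by rw [hS]; exact Nat.lt_floor_add_one _
  have hT₁r : (T₁ : ℝ) = 10 * D := by rw [hT₁]; push_cast; ring
  have hS₁r : (S₁ : ℝ) = 40 * D := by rw [hS₁]; push_cast; ring
  have hLr : (L : ℝ) = (T + 1) * (2 * (10 * D) + 1) := by rw [hL, hT₁]; push_cast; ring
  have h3a : 2 * T₁ < S + 1 := by
    have h : (2 * T₁ : ℝ) < S + 1 := by rw [hT₁r]; nlinarith
    exact_mod_cast h
  have h3 : (2 * T₁ + 1) * T < (S + 1 - 2 * T₁) * (2 * S₁ + 1) := by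
    have h1 : ((2 : ℝ) * (10 * D) + 1) * T ≤ (2 * (10 * D) + 1) * (3000 * D * V) :=
      mul_le_mul_of_nonneg_left hTle (by positivity)
    have h2 := ineq_zero_estimate D V hDr hV1
    have h4 : (1200 * (D : ℝ) * V - 2 * (10 * D)) * (2 * (40 * D) + 1) ≤
        ((S : ℝ) + 1 - 2 * (10 * D)) * (2 * (40 * D) + 1) :=
      mul_le_mul_of_nonneg_right (by linarith) (by positivity)
    have key : (((2 * T₁ + 1) * T : ℕ) : ℝ) < (((S + 1 - 2 * T₁) * (2 * S₁ + 1) : ℕ) : ℝ) := by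
      push_cast [Nat.cast_sub h3a.le]
      rw [hT₁r, hS₁r]
      linarith
    exact_mod_cast key
  have hLlo : 60000 * (D : ℝ) ^ 2 * V < L := by rw [hLr]; exact ineq_L_lower D V T hDr hV1 hTlt
  have hLhi : (L : ℝ) ≤ 63021 * (D : ℝ) ^ 2 * V := by rw [hLr]; exact ineq_L_upper D V T hDr hV1 hTle
  have hΦ : (L : ℝ) * lgE ≤ 63021 * (D : ℝ) ^ 2 * X := by
    calc (L : ℝ) * lgE ≤ 63021 * (D : ℝ) ^ 2 * V * lgE := mul_le_mul_of_nonneg_right hLhi hlgE0.le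
      _ = 63021 * (D : ℝ) ^ 2 * X := by rw [← hVX]; ring
  exact ⟨h3a, h3, hLlo, hLhi, hΦ⟩

/-! ### The five terms of the main inequality, in the unit `D² X` -/

/-- `log 2 + D log L ≤ 13 D² X`. [folklore] -/
theorem term_a1 (D L lgE X : ℝ) (hD : 1 ≤ D) (hX : 2 ≤ X) (hlogL : Real.log L ≤ 12 * lgE)
    (hlgEX : lgE ≤ X) : Real.log 2 + D * Real.log L ≤ 13 * (D ^ 2 * X) := by
  have hlog2 : Real.log 2 < 1 := by have := Real.log_two_lt_d9; linarith
  have h1 : D * Real.log L ≤ D * (12 * lgE) := mul_le_mul_of_nonneg_left hlogL (by linarith)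
  have h2 : D * (12 * lgE) ≤ D * (12 * X) := mul_le_mul_of_nonneg_left (by linarith) (by linarith)
  have h3 : D * X ≤ D ^ 2 * X := by
    nlinarith [mul_nonneg (mul_nonneg (sub_nonneg.2 hD) (by linarith : (0 : ℝ) ≤ D))
      (by linarith : (0 : ℝ) ≤ X)]
  have h4 : 1 ≤ D ^ 2 * X := by nlinarith
  linarith

/-- `D (T log S₁ + S log(T+T₁)) ≤ 17400 D² X`. [folklore] -/
theorem term_a2 (D V lgE X T S lS lT : ℝ) (hD : 1 ≤ D) (hV : 1 ≤ V)
    (hVX : V * lgE = X) (hT : T ≤ 3000 * D * V) (hS : S ≤ 1200 * D * V) (hlS : lS ≤ 3 * lgE)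
    (hlS0 : 0 ≤ lS) (hlT : lT ≤ 7 * lgE) (hlT0 : 0 ≤ lT) :
    D * (T * lS + S * lT) ≤ 17400 * (D ^ 2 * X) := by
  have h1 : T * lS ≤ 3000 * D * V * (3 * lgE) := mul_le_mul hT hlS hlS0 (by positivity)
  have h2 : S * lT ≤ 1200 * D * V * (7 * lgE) := mul_le_mul hS hlT hlT0 (by positivity)
  have h3 : 3000 * D * V * (3 * lgE) + 1200 * D * V * (7 * lgE) = 17400 * (D * X) := by
    rw [← hVX]; ring
  have h5 : T * lS + S * lT ≤ 17400 * (D * X) := by linarith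
  calc D * (T * lS + S * lT) ≤ D * (17400 * (D * X)) := mul_le_mul_of_nonneg_left h5 (by linarith)
    _ = 17400 * (D ^ 2 * X) := by ring

/-- `(T + S) log E ≤ 4200 D² X`. [folklore] -/
theorem term_a3 (D V lgE X T S : ℝ) (hD : 1 ≤ D) (hlgE : 0 ≤ lgE) (hX : 0 ≤ X)
    (hVX : V * lgE = X) (hT : T ≤ 3000 * D * V) (hS : S ≤ 1200 * D * V) :
    (T + S) * lgE ≤ 4200 * (D ^ 2 * X) := by
  have h3 : D * X ≤ D ^ 2 * X := by
    nlinarith [mul_nonneg (mul_nonneg (sub_nonneg.2 hD) (by linarith : (0 : ℝ) ≤ D)) hX]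
  calc (T + S) * lgE ≤ (4200 * D * V) * lgE := mul_le_mul_of_nonneg_right (by linarith) hlgE
    _ = 4200 * (D * X) := by rw [← hVX]; ring
    _ ≤ 4200 * (D ^ 2 * X) := by linarith

/-- `2mℓ + m log 4 ≤ 440 L D² X`. [folklore] -/
theorem term_a5 (D X ℓ T L m : ℝ) (hD : 1 ≤ D) (hX : 0 < X) (hℓX : ℓ + 1 ≤ X) (hT0 : 0 ≤ T)
    (hL : L = (T + 1) * (2 * (10 * D) + 1)) (hm : m = 40 * D * (T + 1) * (10 * D * (10 * D + 1))) :
    2 * m * ℓ + m * Real.log 4 ≤ 440 * L * (D ^ 2 * X) := by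
  have hlog4 : Real.log 4 < 2 := by
    have h : Real.log 4 = 2 * Real.log 2 := by
      rw [show (4 : ℝ) = 2 ^ 2 by norm_num, Real.log_pow]; push_cast; ring
    have := Real.log_two_lt_d9
    linarith
  have hm0 : 0 ≤ m := by rw [hm]; positivity
  have hm2 : 2 * m ≤ 440 * L * D ^ 2 := by rw [hm, hL]; exact ineq_m D T hD hT0
  calc 2 * m * ℓ + m * Real.log 4 ≤ 2 * m * (ℓ + 1) := by nlinarith
    _ ≤ 2 * m * X := mul_le_mul_of_nonneg_left hℓX (by positivity)
    _ ≤ 440 * L * D ^ 2 * X := mul_le_mul_of_nonneg_right hm2 hX.le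
    _ = 440 * L * (D ^ 2 * X) := by ring

/-- The final comparison: terms `≤ 22701 Y` and `≤ 440 L Y` against `½L(L-1) log E ≥ 29999 L Y`,
`Y = D² X`. [folklore] -/
theorem final_comparison (L Y lgE X D V A B : ℝ) (hY : Y = D ^ 2 * X) (hY0 : 0 < Y) (hL0 : 0 < L)
    (hVX : V * lgE = X) (hlgE : 0 ≤ lgE) (hlgEX : lgE ≤ X) (hXY : X ≤ Y)
    (hLlo : 60000 * D ^ 2 * V < L) (hA : A ≤ 22701 * Y) (hB : B ≤ 440 * L * Y) :
    L * A + B < L * (L - 1) / 2 * lgE := by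
  have h1 : 59999 * Y ≤ (L - 1) * lgE := by
    have h2 : (60000 * D ^ 2 * V - 1) * lgE ≤ (L - 1) * lgE :=
      mul_le_mul_of_nonneg_right (by linarith) hlgE
    have h3 : (60000 * D ^ 2 * V - 1) * lgE = 60000 * Y - lgE := by rw [hY, ← hVX]; ring
    linarith
  have h4 := mul_le_mul_of_nonneg_left h1 hL0.le
  have h5 := mul_le_mul_of_nonneg_left hA hL0.le
  have : 0 < L * Y := by positivity
  linarith

/-- **The main inequality** ([NesterenkoWaldschmidt1996, §6 (d)] for `θ = β = 1`, monomial
variant): with the parameters above (`D ≥ 1`, `ℓ ≥ 1`, `X = D + ℓ`, `log E = 1 + log X`,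
`V log E = X`, `1 ≤ V ≤ X`, `T ≤ 3000DV`, `S ≤ 1200DV`, `60000D²V < L ≤ 63021D²V`,
`m = S₁(T+1)T₁(T₁+1)`, `E = eX`, `T₁ = 10D`, `S₁ = 40D`):
`L log 2 + DL log L + DL(T log S₁ + S log(T+T₁)) + (T+S)L log E + L E T₁ S₁ + 2mℓ + m log 4
 < ½L(L-1) log E`. [cite: NesterenkoWaldschmidt1996, §6] -/
theorem params_main (D : ℕ) (hD : 1 ≤ D) (ℓ : ℝ) (hℓ : 1 ≤ ℓ) {X E lgE V : ℝ} (hX : X = D + ℓ)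
    (hE : E = Real.exp 1 * X) (hlgE : lgE = 1 + Real.log X) (hVX : V * lgE = X) (hV1 : 1 ≤ V)
    (hVleX : V ≤ X) {T₁ S₁ T S L m : ℕ} (hT₁ : T₁ = 10 * D) (hS₁ : S₁ = 40 * D)
    (hTle : (T : ℝ) ≤ 3000 * D * V) (hSle : (S : ℝ) ≤ 1200 * D * V)
    (hLlo : 60000 * (D : ℝ) ^ 2 * V < L) (hLhi : (L : ℝ) ≤ 63021 * (D : ℝ) ^ 2 * V)
    (hL : L = (T + 1) * (2 * T₁ + 1)) (hm : m = S₁ * (T + 1) * (T₁ * (T₁ + 1))) :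
    (L : ℝ) * Real.log 2 + D * L * Real.log L +
          D * L * (T * Real.log S₁ + S * Real.log ((T : ℝ) + T₁)) +
          ((T : ℝ) + S) * L * lgE + L * (E * T₁ * S₁) + 2 * m * ℓ + m * Real.log 4 <
      (L : ℝ) * (L - 1) / 2 * lgE := by
  obtain ⟨-, he2⟩ := e_bounds
  have hDr : (1 : ℝ) ≤ D := by exact_mod_cast hD
  have hX2 : 2 ≤ X := by rw [hX]; linarith
  have hXpos : 0 < X := by linarith
  have hDX : (D : ℝ) ≤ X := by rw [hX]; linarith
  have hℓX : ℓ + 1 ≤ X := by rw [hX]; linarith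
  have hlogX0 : 0 ≤ Real.log X := Real.log_nonneg (by linarith)
  have hlgEpos : 0 < lgE := by rw [hlgE]; linarith
  have hlgEX : lgE ≤ X := by
    rw [hlgE]; have := Real.log_le_sub_one_of_pos hXpos; linarith
  have hT0 : (0 : ℝ) ≤ T := Nat.cast_nonneg _
  have hT₁r : (T₁ : ℝ) = 10 * D := by rw [hT₁]; push_cast; ring
  have hS₁r : (S₁ : ℝ) = 40 * D := by rw [hS₁]; push_cast; ring
  have hLr : (L : ℝ) = (T + 1) * (2 * (10 * D) + 1) := by rw [hL, hT₁]; push_cast; ring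
  have hmr : (m : ℝ) = 40 * D * (T + 1) * (10 * D * (10 * D + 1)) := by
    rw [hm, hS₁, hT₁]; push_cast; ring
  have hLpos : (0 : ℝ) < L := lt_of_le_of_lt (by positivity) hLlo
  -- logarithms
  have hlogL : Real.log L ≤ 12 * lgE := by
    rw [hlgE]; exact log_L_le D V X L hDr hV1 hX2 hDX hVleX hLpos hLhi
  have hlogS₁ : Real.log S₁ ≤ 3 * lgE := by
    rw [hS₁r, hlgE]; exact log_S₁_le D X hDr hX2 hDX
  have hlogS₁0 : 0 ≤ Real.log S₁ := Real.log_nonneg (by rw [hS₁r]; linarith)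
  have hlogTT : Real.log ((T : ℝ) + T₁) ≤ 7 * lgE := by
    rw [hT₁r, hlgE]; exact log_TT₁_le D V X T hDr hV1 hX2 hDX hVleX hT0 hTle
  have hlogTT0 : 0 ≤ Real.log ((T : ℝ) + T₁) := Real.log_nonneg (by rw [hT₁r]; linarith)
  -- the five terms
  have a1 := term_a1 D L lgE X hDr hX2 hlogL hlgEX
  have a2 := term_a2 D V lgE X T S _ _ hDr hV1 hVX hTle hSle hlogS₁ hlogS₁0 hlogTT hlogTT0
  have a3 := term_a3 D V lgE X T S hDr hlgEpos.le hXpos.le hVX hTle hSle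
  have a4 : E * T₁ * S₁ ≤ 1088 * ((D : ℝ) ^ 2 * X) := by
    rw [hE, hT₁r, hS₁r]; exact ineq_ET₁S₁ D X _ hXpos he2
  have a5 := term_a5 D X ℓ T L m hDr hXpos hℓX hT0 hLr hmr
  -- the comparison
  have hXY : X ≤ (D : ℝ) ^ 2 * X := le_mul_of_one_le_left hXpos.le (one_le_pow₀ hDr)
  have hA : (Real.log 2 + D * Real.log L) + D * (T * Real.log S₁ + S * Real.log ((T : ℝ) + T₁)) +
      ((T : ℝ) + S) * lgE + E * T₁ * S₁ ≤ 22701 * ((D : ℝ) ^ 2 * X) := by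
    linarith only [a1, a2, a3, a4]
  have hfin := final_comparison L ((D : ℝ) ^ 2 * X) lgE X D V _ _ rfl (by positivity) hLpos hVX
    hlgEpos.le hlgEX hXY hLlo hA a5
  have hsum : (L : ℝ) * Real.log 2 + D * L * Real.log L +
        D * L * (T * Real.log S₁ + S * Real.log ((T : ℝ) + T₁)) +
        ((T : ℝ) + S) * L * lgE + L * (E * T₁ * S₁) + 2 * m * ℓ + m * Real.log 4 =
      L * ((Real.log 2 + D * Real.log L) + D * (T * Real.log S₁ + S * Real.log ((T : ℝ) + T₁)) +
        ((T : ℝ) + S) * lgE + E * T₁ * S₁) + (2 * m * ℓ + m * Real.log 4) := by ring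
  rw [hsum]
  exact hfin

end NW1996

end Literature.NumberTheory.Transcendental

end
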